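import Summits.HodgeConjecture.CorCM.Census.CentralSquaresPartnersTransversal

/-!
# The square-central class, LIII: star normal forms at level `m + 2` in a MULTI-PARTNER base block (toward `T₀`)

COR-CM (cell `pub-hodgecm2`), count-neutral kernel combinatorics by the binder seat b09 (gen 50; lane SQUARE-CENTRAL CLASS, part LIII), on part LI
(`Census/CentralSquaresPartnersTransversal.lean`: the exchanged multi-partner frame, `hbase_exchange_partners`, `card_sdiff_exchange_partners`), part IV §3
(`single_sub_thetaG_mem_transversal_pair`, whose proof is re-run here), part I (`strict_rt`), parts III, V, VI (`ddist_*`, `rt_eq_self_of_transversal`,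
`cover_frame`, `sdiff_eq_of_dev`, `thetaG_frame`, `card_frame`) and gen 32ʼs `single_sub_thetaG_mem_of`, all BY NAME.  Theorems only: no definition, no
`decide`, no certificate, no named fact, no `sorry`.  HONEST FRAMING: `HC_CM` is NOT proved, here or anywhere in the tree; nothing here is a period or a
headline.

THE SETTING of parts LI–LII (multi-partner block, dihedral-type partner `T₁` with swap `Q`, strict lowering cover in a base-change stable `L`), at LEVEL
`m + 2`: the type with deviation set `T ∪ {a, a'}` (`T ⊆ 𝓗` a transversal of the swap, `|T| = m ≥ 3`, `a ∈ T₀ ∩ T₁`, `a' = σa ≠ a`).  In a four-type block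
(part IV §3) the metric of these types and of their corners involves `T₀, T̄₀, T₁, T̄₁` only; with more partners we ASSUME that every other partner and its
complement are strictly farther than `T₀` from every type of the class `D ⊆ T ∪ {a, a'}` (`hfar₀`), and strictly farther than `T₁` from every type of the
exchanged class (`hfar₁`) — in the affine rank-two blocks this is `3 ≤ |T ∩ 𝓗'| ≤ m − 3` for the other partners `T'`, i.e. `m ≥ 8`; the order-`32` rows
(`m = 4`) are the boundary where it fails.

* §0 the four-type metric with far partners: `bpot_eq_card_dev_of_le_far`, `unique_T₀_of_lt_far`.
* §1 `single_sub_thetaG_mem_transversal_pair_partners` (`m ≥ 3`): star normal form toward `T₀` of every type of the class whose deviation set is all of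
  `T ∪ {a, a'}` or does not contain `T` (part IV §3 verbatim on §0).
The exchanged version (toward `T₁`) and THE PAIR RELATION `R(T) + Y'_a + Y'_{a'} ∈ L` follow in `Census/CentralSquaresPartnersPairRelation.lean`.

## References
* [Pohlmann1968] H. Pohlmann, Algebraic cycles on abelian varieties of complex multiplication type, Ann. of Math. 88 (1968), Thm 1.
-/

namespace Summit.HodgeConjecture.CorCM.Census.CentralSquares

open Finset
open scoped symmDiff
open Summit.HodgeConjecture.CorCM.Prior.AllgGroup.RfwfAllgGroup
open Summit.HodgeConjecture.CorCM.Census.BlockParity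
open Summit.HodgeConjecture.CorCM.Census.Coinvariant
open Summit.HodgeConjecture.CorCM.Census.TwistGeneration
open Summit.HodgeConjecture.CorCM.Census.BaseBlock
open Summit.HodgeConjecture.CorCM.Census.CoverClosure

noncomputable section

variable {G : Type*} [Group G] [Fintype G] [DecidableEq G] (c : G)

section Frame

variable (hc2 : c * c = 1) (hcen : ∀ x : G, x * c = c * x) (T₀ : CMF G c) (𝒯 : Finset (CMF G c))
variable (hbase : ∀ Q : G, rt c Q T₀ = T₀ ∨ rt c Q T₀ = rt c c T₀ ∨ ∃ T₁ ∈ 𝒯, rt c Q T₀ = T₁ ∨ rt c Q T₀ = rt c c T₁)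
variable (m : ℕ) (hn : T₀.1.card = 4 * m) (hH : ∀ T₁ ∈ 𝒯, (T₀.1 \ T₁.1).card = 2 * m)
variable (hpair : ∀ T₁ ∈ 𝒯, ∀ T₂ ∈ 𝒯, T₁ ≠ T₂ → ((T₀.1 \ T₁.1) ∆ (T₀.1 \ T₂.1)).card = 2 * m)
variable (T₁ : CMF G c) (hT₁ : T₁ ∈ 𝒯) (Q : G) (hQ : rt c Q T₀ = T₁) (hQQ : Q * Q = 1)
variable (L : Submodule ℤ (CMF G c →₀ ℤ)) (hLrt : ∀ (Q' : G) (y : CMF G c →₀ ℤ), y ∈ L → Finsupp.mapDomain (rt c Q') y ∈ L)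
variable (hcover : ∀ Ψ : CMF G c, 2 ≤ bpot c T₀ Ψ → ∃ Q₂ s s' : G, bpot c T₀ Ψ = ddist (rt c Q₂ T₀) Ψ ∧
    s ∈ (rt c Q₂ T₀).1 \ Ψ.1 ∧ s' ∈ (rt c Q₂ T₀).1 \ Ψ.1 ∧ s ≠ s' ∧
    gface c hc2 Ψ s s' ∈ L ∧
    ((∃ Q₁ t t' : G, bpot c T₀ Ψ = ddist (rt c Q₁ T₀) Ψ ∧ t ∈ (rt c Q₁ T₀).1 \ Ψ.1 ∧ t' ∈ (rt c Q₁ T₀).1 \ Ψ.1 ∧ t ≠ t' ∧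
        (∀ Q' : G, ddist (rt c Q' T₀) (oflipCM c hc2 t Ψ) = bpot c T₀ (oflipCM c hc2 t Ψ) → rt c Q' T₀ = rt c Q₁ T₀) ∧
        (∀ Q' : G, ddist (rt c Q' T₀) (oflipCM c hc2 t' Ψ) = bpot c T₀ (oflipCM c hc2 t' Ψ) → rt c Q' T₀ = rt c Q₁ T₀) ∧
        (∀ Q' : G, ddist (rt c Q' T₀) (oflipCM c hc2 t (oflipCM c hc2 t' Ψ)) = bpot c T₀ (oflipCM c hc2 t (oflipCM c hc2 t' Ψ)) →
          rt c Q' T₀ = rt c Q₁ T₀)) →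
      (∀ Q' : G, ddist (rt c Q' T₀) (oflipCM c hc2 s Ψ) = bpot c T₀ (oflipCM c hc2 s Ψ) → rt c Q' T₀ = rt c Q₂ T₀) ∧
      (∀ Q' : G, ddist (rt c Q' T₀) (oflipCM c hc2 s' Ψ) = bpot c T₀ (oflipCM c hc2 s' Ψ) → rt c Q' T₀ = rt c Q₂ T₀) ∧
      (∀ Q' : G, ddist (rt c Q' T₀) (oflipCM c hc2 s (oflipCM c hc2 s' Ψ)) = bpot c T₀ (oflipCM c hc2 s (oflipCM c hc2 s' Ψ)) →
        rt c Q' T₀ = rt c Q₂ T₀)))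

/-! ## §0 The four-type metric with far partners -/

include hc2 hcen hbase hT₁ in
/-- **`bpot X = |D|`** when `|D|` is at most the distances to `T̄₀`, `T₁`, `T̄₁` and to every other partner and its complement. [folklore] -/
theorem bpot_eq_card_dev_of_le_far (X : CMF G c)
    (h1 : (T₀.1 \ X.1).card ≤ T₀.1.card - (T₀.1 \ X.1).card)
    (h2 : (T₀.1 \ X.1).card ≤ ((T₀.1 \ T₁.1) ∆ (T₀.1 \ X.1)).card)
    (h3 : (T₀.1 \ X.1).card ≤ T₀.1.card - ((T₀.1 \ T₁.1) ∆ (T₀.1 \ X.1)).card)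
    (hf : ∀ T₂ ∈ 𝒯, T₂ ≠ T₁ → (T₀.1 \ X.1).card ≤ ddist T₂ X ∧ (T₀.1 \ X.1).card ≤ ddist (rt c c T₂) X) :
    bpot c T₀ X = (T₀.1 \ X.1).card := by
  apply le_antisymm
  · have h := bpot_le c T₀ X 1; rwa [rt_one] at h
  · obtain ⟨Q', hQ'⟩ := exists_bpot_eq c T₀ X
    rw [hQ']
    rcases hbase Q' with h | h | ⟨T₂, hT₂, h | h⟩ <;> rw [h]
    · exact le_rfl
    · rw [ddist_compl_base_eq c T₀ hc2 hcen]; exact h1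
    · by_cases h12 : T₂ = T₁
      · subst h12; rw [ddist_eq_card_symmDiff c T₀ hc2]; exact h2
      · exact (hf T₂ hT₂ h12).1
    · by_cases h12 : T₂ = T₁
      · subst h12; rw [ddist_compl_eq c T₀ hc2 hcen]; exact h3
      · exact (hf T₂ hT₂ h12).2

include hc2 hcen hbase hT₁ in
/-- **`T₀` UNIQUELY nearest** when `|D|` is STRICTLY smaller than the distances to `T̄₀`, `T₁`, `T̄₁`, the other partners and their complements. [folklore] -/
theorem unique_T₀_of_lt_far (X : CMF G c)
    (h1 : (T₀.1 \ X.1).card < T₀.1.card - (T₀.1 \ X.1).card)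
    (h2 : (T₀.1 \ X.1).card < ((T₀.1 \ T₁.1) ∆ (T₀.1 \ X.1)).card)
    (h3 : (T₀.1 \ X.1).card < T₀.1.card - ((T₀.1 \ T₁.1) ∆ (T₀.1 \ X.1)).card)
    (hf : ∀ T₂ ∈ 𝒯, T₂ ≠ T₁ → (T₀.1 \ X.1).card < ddist T₂ X ∧ (T₀.1 \ X.1).card < ddist (rt c c T₂) X) :
    ∀ Q' : G, ddist (rt c Q' T₀) X = bpot c T₀ X → rt c Q' T₀ = rt c (1 : G) T₀ := by
  intro Q' hQ'
  rw [rt_one]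
  rw [bpot_eq_card_dev_of_le_far c hc2 hcen T₀ 𝒯 hbase T₁ hT₁ X h1.le h2.le h3.le
    (fun T₂ hT₂ h12 => ⟨(hf T₂ hT₂ h12).1.le, (hf T₂ hT₂ h12).2.le⟩)] at hQ'
  rcases hbase Q' with h | h | ⟨T₂, hT₂, h | h⟩
  · exact h
  · exfalso; rw [h, ddist_compl_base_eq c T₀ hc2 hcen] at hQ'; omega
  · exfalso
    by_cases h12 : T₂ = T₁
    · subst h12; rw [h, ddist_eq_card_symmDiff c T₀ hc2] at hQ'; omega
    · have h' := (hf T₂ hT₂ h12).1; rw [← h, hQ'] at h'; exact lt_irrefl _ h'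
  · exfalso
    by_cases h12 : T₂ = T₁
    · subst h12; rw [h, ddist_compl_eq c T₀ hc2 hcen] at hQ'; omega
    · have h' := (hf T₂ hT₂ h12).2; rw [← h, hQ'] at h'; exact lt_irrefl _ h'

/-! ## §1 Level `m + 2` toward `T₀` -/

include hcen hbase hn hH hT₁ hQ hQQ hLrt hcover in
/-- **STAR NORMAL FORM AT LEVEL `m + 2` (multi-partner block, `m ≥ 3`).**  For a transversal `T ⊆ 𝓗` of the swap of size `m`, `a ∈ T₀ ∖ 𝓗` with image
`a' ≠ a`, and the other partners far from the class (`hfar₀`): every type `X` whose deviation set is contained in `T ∪ {a, a'}` and is all of it or does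
not contain `T` satisfies `[X] − θ_{T₀}(typeSum [X]) ∈ L`. [folklore] -/
theorem single_sub_thetaG_mem_transversal_pair_partners (hm : 3 ≤ m)
    (hσH : ∀ t ∈ T₀.1, ∀ t' ∈ T₀.1, (t' = t * Q ∨ t' = c * (t * Q)) → (t ∈ T₀.1 \ T₁.1 ↔ t' ∈ T₀.1 \ T₁.1))
    (T : Finset G) (hTH : T ⊆ T₀.1 \ T₁.1) (hTm : T.card = m)
    (hT : ∀ t ∈ T₀.1 \ T₁.1, ∀ t' ∈ T₀.1, (t' = t * Q ∨ t' = c * (t * Q)) → (t ∈ T ↔ t' ∉ T))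
    {a a' : G} (ha : a ∈ T₀.1) (haH : a ∉ T₀.1 \ T₁.1) (ha' : a' ∈ T₀.1) (haa' : a' = a * Q ∨ a' = c * (a * Q)) (hne : a ≠ a')
    (hfar₀ : ∀ T₂ ∈ 𝒯, T₂ ≠ T₁ → ∀ X : CMF G c, T₀.1 \ X.1 ⊆ T ∪ {a, a'} →
      (T₀.1 \ X.1).card < ddist T₂ X ∧ (T₀.1 \ X.1).card < ddist (rt c c T₂) X) :
    ∀ X : CMF G c, (T₀.1 \ X.1 ⊆ T ∪ {a, a'} ∧ (T₀.1 \ X.1 = T ∪ {a, a'} ∨ ¬ T ⊆ T₀.1 \ X.1)) →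
      Finsupp.single X 1 - thetaG c hc2 T₀ (typeSum G c (Finsupp.single X 1)) ∈ L := by
  have hHsub : T₀.1 \ T₁.1 ⊆ T₀.1 := sdiff_subset
  have ha'H : a' ∉ T₀.1 \ T₁.1 := fun h => haH ((hσH a ha a' ha' haa').mpr h)
  have hA : ({a, a'} : Finset G) ⊆ T₀.1 \ (T₀.1 \ T₁.1) := by
    intro x hx; rw [mem_insert, mem_singleton] at hx
    rcases hx with rfl | rfl
    · exact mem_sdiff.mpr ⟨ha, haH⟩
    · exact mem_sdiff.mpr ⟨ha', ha'H⟩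
  have hAdisj : Disjoint ({a, a'} : Finset G) (T₀.1 \ T₁.1) := by
    rw [disjoint_iff_ne]; rintro x hx y hy rfl; exact (mem_sdiff.mp (hA hx)).2 hy
  have hTA : Disjoint T ({a, a'} : Finset G) := by
    rw [disjoint_iff_ne]; rintro x hx y hy rfl; exact (mem_sdiff.mp (hA hy)).2 (hTH hx)
  have hcardTA : (T ∪ {a, a'}).card = m + 2 := by rw [card_union_of_disjoint hTA, hTm, card_pair hne]
  have hT₀₁ : T₁ ≠ T₀ := by
    intro h; have h' := hH T₁ hT₁; rw [h, Finset.sdiff_self, Finset.card_empty] at h'; omega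
  -- the symmetric difference with `𝓗` of a set `S ∪ B`, `S ⊆ T`, `B ⊆ {a, a'}`
  have hsdcard : ∀ S B : Finset G, S ⊆ T → B ⊆ {a, a'} →
      ((T₀.1 \ T₁.1) ∆ (S ∪ B)).card = 2 * m - S.card + B.card := fun S B hS hB => by
    rw [card_symmDiff_union _ S B (hS.trans hTH) (disjoint_of_subset_left hB hAdisj), hH T₁ hT₁]
  -- uniqueness of the nearest base change `T₀` for `D = S ∪ B`, `|S| < m`, `B ⊆ {a,a'}`
  have huniq : ∀ X : CMF G c, ∀ S B : Finset G, S ⊆ T → B ⊆ {a, a'} → S.card < m → T₀.1 \ X.1 = S ∪ B →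
      bpot c T₀ X = (T₀.1 \ X.1).card ∧ ∀ Q' : G, ddist (rt c Q' T₀) X = bpot c T₀ X → rt c Q' T₀ = rt c (1 : G) T₀ := by
    intro X S B hS hB hSm hD
    have hBcard : B.card ≤ 2 := (card_le_card hB).trans (by rw [card_pair hne])
    have hdisj : Disjoint S B := disjoint_of_subset_left hS (disjoint_of_subset_right hB hTA)
    have hDcard : (T₀.1 \ X.1).card = S.card + B.card := by rw [hD, card_union_of_disjoint hdisj]
    have hsd : ((T₀.1 \ T₁.1) ∆ (T₀.1 \ X.1)).card = 2 * m - S.card + B.card := by rw [hD]; exact hsdcard S B hS hB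
    have h1 : (T₀.1 \ X.1).card < T₀.1.card - (T₀.1 \ X.1).card := by rw [hn, hDcard]; omega
    have h2 : (T₀.1 \ X.1).card < ((T₀.1 \ T₁.1) ∆ (T₀.1 \ X.1)).card := by rw [hsd, hDcard]; omega
    have h3 : (T₀.1 \ X.1).card < T₀.1.card - ((T₀.1 \ T₁.1) ∆ (T₀.1 \ X.1)).card := by rw [hsd, hn, hDcard]; omega
    have hf := fun T₂ hT₂ h12 => hfar₀ T₂ hT₂ h12 X (by rw [hD]; exact union_subset_union hS hB)
    exact ⟨bpot_eq_card_dev_of_le_far c hc2 hcen T₀ 𝒯 hbase T₁ hT₁ X h1.le h2.le h3.le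
        (fun T₂ hT₂ h12 => ⟨(hf T₂ hT₂ h12).1.le, (hf T₂ hT₂ h12).2.le⟩),
      unique_T₀_of_lt_far c hc2 hcen T₀ 𝒯 hbase T₁ hT₁ X h1 h2 h3 hf⟩
  -- decomposition of a deviation set `D ⊆ T ∪ {a,a'}`
  have hdecomp : ∀ D : Finset G, D ⊆ T ∪ {a, a'} → D = (D ∩ T) ∪ (D ∩ {a, a'}) := fun D hD => by
    ext x; simp only [mem_union, mem_inter]
    constructor
    · intro hx; rcases mem_union.mp (hD hx) with h | h
      · exact Or.inl ⟨hx, h⟩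
      · exact Or.inr ⟨hx, h⟩
    · rintro (⟨h, -⟩ | ⟨h, -⟩) <;> exact h
  refine single_sub_thetaG_mem_of c T₀ (fun X => T₀.1 \ X.1 ⊆ T ∪ {a, a'} ∧ (T₀.1 \ X.1 = T ∪ {a, a'} ∨ ¬ T ⊆ T₀.1 \ X.1))
    hc2 L fun X hX h2 => ?_
  obtain ⟨hXsub, hXor⟩ := hX
  have hcornerU : ∀ s ∈ T₀.1 \ X.1, s ∈ T → (T₀.1 \ (oflipCM c hc2 s X).1 ⊆ T ∪ {a, a'} ∧
      (T₀.1 \ (oflipCM c hc2 s X).1 = T ∪ {a, a'} ∨ ¬ T ⊆ T₀.1 \ (oflipCM c hc2 s X).1)) := by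
    intro s hs hsT
    rw [dev_oflip c hc2 (mem_sdiff.mp hs).1 (mem_sdiff.mp hs).2]
    exact ⟨(erase_subset _ _).trans hXsub, Or.inr fun h => (notMem_erase s _) (h hsT)⟩
  have hcornerU' : ∀ s ∈ T₀.1 \ X.1, ¬ T ⊆ T₀.1 \ X.1 → (T₀.1 \ (oflipCM c hc2 s X).1 ⊆ T ∪ {a, a'} ∧
      (T₀.1 \ (oflipCM c hc2 s X).1 = T ∪ {a, a'} ∨ ¬ T ⊆ T₀.1 \ (oflipCM c hc2 s X).1)) := by
    intro s hs hnT
    rw [dev_oflip c hc2 (mem_sdiff.mp hs).1 (mem_sdiff.mp hs).2]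
    exact ⟨(erase_subset _ _).trans hXsub, Or.inr fun h => hnT (h.trans (erase_subset _ _))⟩
  have hmem_flip : ∀ s ∈ T₀.1 \ X.1, ∀ s' ∈ T₀.1 \ X.1, s ≠ s' → s ∈ T₀.1 \ (oflipCM c hc2 s' X).1 := by
    intro s hs s' hs' hss'
    rw [dev_oflip c hc2 (mem_sdiff.mp hs').1 (mem_sdiff.mp hs').2]; exact mem_erase.mpr ⟨hss', hs⟩
  rcases hXor with hXeq | hnT
  · -- the top type: deviation set `T ∪ {a, a'}`
    have hcardD : (T₀.1 \ X.1).card = m + 2 := by rw [hXeq, hcardTA]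
    have hsdD : ((T₀.1 \ T₁.1) ∆ (T₀.1 \ X.1)).card = m + 2 := by
      rw [hXeq, hsdcard T {a, a'} Subset.rfl Subset.rfl, hTm, card_pair hne]; omega
    have hfX := fun T₂ hT₂ h12 => hfar₀ T₂ hT₂ h12 X hXsub
    have hbp : bpot c T₀ X = m + 2 := by
      rw [← hcardD]
      refine bpot_eq_card_dev_of_le_far c hc2 hcen T₀ 𝒯 hbase T₁ hT₁ X ?_ ?_ ?_
        (fun T₂ hT₂ h12 => ⟨(hfX T₂ hT₂ h12).1.le, (hfX T₂ hT₂ h12).2.le⟩)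
      · rw [hn, hcardD]; omega
      · rw [hsdD, hcardD]
      · rw [hn, hsdD, hcardD]; omega
    have hstrictT : ∀ t₁ ∈ T, ∀ t₂ ∈ T, t₁ ≠ t₂ →
        (∀ Q' : G, ddist (rt c Q' T₀) (oflipCM c hc2 t₁ X) = bpot c T₀ (oflipCM c hc2 t₁ X) → rt c Q' T₀ = rt c (1 : G) T₀) ∧
        (∀ Q' : G, ddist (rt c Q' T₀) (oflipCM c hc2 t₁ (oflipCM c hc2 t₂ X)) = bpot c T₀ (oflipCM c hc2 t₁ (oflipCM c hc2 t₂ X)) →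
          rt c Q' T₀ = rt c (1 : G) T₀) := by
      intro t₁ ht₁ t₂ ht₂ h12
      have ht₁D : t₁ ∈ T₀.1 \ X.1 := by rw [hXeq]; exact mem_union_left _ ht₁
      have ht₂D : t₂ ∈ T₀.1 \ X.1 := by rw [hXeq]; exact mem_union_left _ ht₂
      have hnot : ∀ t ∈ T, t ∉ ({a, a'} : Finset G) := fun t ht h => (disjoint_left.mp hTA ht) h
      have hD1 : T₀.1 \ (oflipCM c hc2 t₁ X).1 = T.erase t₁ ∪ {a, a'} := by
        rw [dev_oflip c hc2 (mem_sdiff.mp ht₁D).1 (mem_sdiff.mp ht₁D).2, hXeq, erase_union_distrib, erase_eq_of_notMem (hnot t₁ ht₁)]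
      have ht₁D' : t₁ ∈ T₀.1 \ (oflipCM c hc2 t₂ X).1 := hmem_flip t₁ ht₁D t₂ ht₂D h12
      have hD12 : T₀.1 \ (oflipCM c hc2 t₁ (oflipCM c hc2 t₂ X)).1 = (T.erase t₂).erase t₁ ∪ {a, a'} := by
        rw [dev_oflip c hc2 (mem_sdiff.mp ht₁D').1 (mem_sdiff.mp ht₁D').2,
          dev_oflip c hc2 (mem_sdiff.mp ht₂D).1 (mem_sdiff.mp ht₂D).2, hXeq, erase_union_distrib, erase_eq_of_notMem (hnot t₂ ht₂),
          erase_union_distrib, erase_eq_of_notMem (hnot t₁ ht₁)]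
      refine ⟨(huniq _ (T.erase t₁) {a, a'} (erase_subset _ _) Subset.rfl ?_ hD1).2,
        (huniq _ ((T.erase t₂).erase t₁) {a, a'} ((erase_subset _ _).trans (erase_subset _ _)) Subset.rfl ?_ hD12).2⟩
      · rw [card_erase_of_mem ht₁, hTm]; omega
      · rw [card_erase_of_mem (mem_erase.mpr ⟨h12, ht₁⟩), card_erase_of_mem ht₂, hTm]; omega
    have hex : ∃ Q₁ t t' : G, bpot c T₀ X = ddist (rt c Q₁ T₀) X ∧ t ∈ (rt c Q₁ T₀).1 \ X.1 ∧ t' ∈ (rt c Q₁ T₀).1 \ X.1 ∧ t ≠ t' ∧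
        (∀ Q' : G, ddist (rt c Q' T₀) (oflipCM c hc2 t X) = bpot c T₀ (oflipCM c hc2 t X) → rt c Q' T₀ = rt c Q₁ T₀) ∧
        (∀ Q' : G, ddist (rt c Q' T₀) (oflipCM c hc2 t' X) = bpot c T₀ (oflipCM c hc2 t' X) → rt c Q' T₀ = rt c Q₁ T₀) ∧
        (∀ Q' : G, ddist (rt c Q' T₀) (oflipCM c hc2 t (oflipCM c hc2 t' X)) = bpot c T₀ (oflipCM c hc2 t (oflipCM c hc2 t' X)) →
          rt c Q' T₀ = rt c Q₁ T₀) := by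
      obtain ⟨t₁, ht₁, t₂, ht₂, h12⟩ := one_lt_card.mp (by rw [hTm]; omega : 1 < T.card)
      refine ⟨1, t₁, t₂, by rw [rt_one, ddist_base_eq, hbp, hcardD], ?_, ?_, h12, (hstrictT t₁ ht₁ t₂ ht₂ h12).1,
        (hstrictT t₂ ht₂ t₁ ht₁ (Ne.symm h12)).1, (hstrictT t₁ ht₁ t₂ ht₂ h12).2⟩
      · rw [rt_one, hXeq]; exact mem_union_left _ ht₁
      · rw [rt_one, hXeq]; exact mem_union_left _ ht₂
    have hface : ∃ s s' : G, s ∈ T₀.1 \ X.1 ∧ s' ∈ T₀.1 \ X.1 ∧ s ≠ s' ∧ gface c hc2 X s s' ∈ L ∧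
        (∀ Q' : G, ddist (rt c Q' T₀) (oflipCM c hc2 s X) = bpot c T₀ (oflipCM c hc2 s X) → rt c Q' T₀ = T₀) ∧
        (∀ Q' : G, ddist (rt c Q' T₀) (oflipCM c hc2 s' X) = bpot c T₀ (oflipCM c hc2 s' X) → rt c Q' T₀ = T₀) := by
      obtain ⟨Q₂, s, s', hQ₂, hs, hs', hss', hmem, hstr⟩ := hcover X (by rw [hbp]; omega)
      obtain ⟨hu1, hu2, hu3⟩ := hstr hex
      have hQ₂' : rt c Q₂ T₀ = T₀ ∨ rt c Q₂ T₀ = T₁ := by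
        rcases hbase Q₂ with h | h | ⟨T₂, hT₂, h | h⟩
        · exact Or.inl h
        · exfalso; rw [h, ddist_compl_base_eq c T₀ hc2 hcen, hbp, hn, hcardD] at hQ₂; omega
        · by_cases h12 : T₂ = T₁
          · subst h12; exact Or.inr h
          · exfalso; have h' := (hfX T₂ hT₂ h12).1; rw [← h, ← hQ₂, hbp, hcardD] at h'; exact lt_irrefl _ h'
        · by_cases h12 : T₂ = T₁
          · subst h12; exfalso; rw [h, ddist_compl_eq c T₀ hc2 hcen, hbp, hn, hsdD] at hQ₂; omega
          · exfalso; have h' := (hfX T₂ hT₂ h12).2; rw [← h, ← hQ₂, hbp, hcardD] at h'; exact lt_irrefl _ h'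
      rcases hQ₂' with h0 | h1
      · rw [h0] at hs hs' hu1 hu2
        exact ⟨s, s', hs, hs', hss', hmem, hu1, hu2⟩
      · have hrep_unique : ∀ x y z : G, x ∈ T₀.1 → y ∈ T₀.1 → (x = z ∨ x = c * z) → (y = z ∨ y = c * z) → x = y := by
          intro x y z hx hy h1 h2
          rcases h1 with rfl | rfl <;> rcases h2 with h | h
          · exact h.symm
          · exact absurd (h ▸ hy) ((T₀.2 x).mp hx)
          · subst h; exact absurd hx ((T₀.2 y).mp hy)
          · exact h.symm
        have haback : a = a' * Q ∨ a = c * (a' * Q) := rep_rep c hc2 hQQ haa'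
        have hAσ : ∀ t ∈ T₀.1 \ (T₀.1 \ T₁.1), ∀ t' ∈ T₀.1, (t' = t * Q ∨ t' = c * (t * Q)) →
            (t ∈ ({a, a'} : Finset G) ↔ t' ∈ ({a, a'} : Finset G)) := by
          intro t ht t' ht' h
          have htT₀ : t ∈ T₀.1 := (mem_sdiff.mp ht).1
          have hback : t = t' * Q ∨ t = c * (t' * Q) := rep_rep c hc2 hQQ h
          rw [mem_insert, mem_singleton, mem_insert, mem_singleton]
          constructor
          · rintro (rfl | rfl)
            · exact Or.inr (hrep_unique t' a' (t * Q) ht' ha' h haa')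
            · exact Or.inl (hrep_unique t' a (t * Q) ht' ha h haback)
          · rintro (rfl | rfl)
            · exact Or.inr (hrep_unique t a' (t' * Q) htT₀ ha' hback haa')
            · exact Or.inl (hrep_unique t a (t' * Q) htT₀ ha hback haback)
        have hstab : rt c Q X = X :=
          rt_eq_self_of_transversal c T₀ Q (T₀.1 \ T₁.1) (by rw [hQ]) hσH X T {a, a'} hXeq hTH hA hT hAσ
        have hT₁Q : rt c Q T₁ = T₀ := by rw [← hQ, ← rt_mul, hQQ, rt_one]
        obtain ⟨h1', hsQ, hs'Q, hneQ, hu1', hu2', -⟩ := strict_rt c T₀ hc2 Q hQ₂ hs hs' hss' hu1 hu2 hu3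
        rw [hstab] at hsQ hs'Q hu1' hu2'
        rw [rt_mul, h1, hT₁Q] at hsQ hs'Q hu1' hu2'
        have hmem' : gface c hc2 X (s * Q⁻¹) (s' * Q⁻¹) ∈ L := by
          have e : gface c hc2 X (s * Q⁻¹) (s' * Q⁻¹) = Finsupp.mapDomain (rt c Q) (gface c hc2 X s s') := by
            rw [mapDomain_rt_gface, hstab]
          rw [e]; exact hLrt Q _ hmem
        exact ⟨_, _, hsQ, hs'Q, hneQ, hmem', hu1', hu2'⟩
    obtain ⟨s, s', hs, hs', hss', hmem, hu1, hu2⟩ := hface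
    -- the two places are in `T`: a place `a` or `a'` would leave a tie corner
    have htie : ∀ b ∈ ({a, a'} : Finset G), ∀ s₀ ∈ T₀.1 \ X.1,
        (∀ Q' : G, ddist (rt c Q' T₀) (oflipCM c hc2 s₀ X) = bpot c T₀ (oflipCM c hc2 s₀ X) → rt c Q' T₀ = T₀) → s₀ ≠ b := by
      intro b hb s₀ hs₀ hu hsb
      subst hsb
      have hD : T₀.1 \ (oflipCM c hc2 s₀ X).1 = T ∪ ({a, a'} : Finset G).erase s₀ := by
        rw [dev_oflip c hc2 (mem_sdiff.mp hs₀).1 (mem_sdiff.mp hs₀).2, hXeq, erase_union_distrib, erase_eq_of_notMem]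
        exact fun h => (disjoint_left.mp hTA h) hb
      have hcard : (T₀.1 \ (oflipCM c hc2 s₀ X).1).card = m + 1 := by
        rw [hD, card_union_of_disjoint (disjoint_of_subset_right (erase_subset _ _) hTA), hTm, card_erase_of_mem hb, card_pair hne]
      have hsd : ((T₀.1 \ T₁.1) ∆ (T₀.1 \ (oflipCM c hc2 s₀ X).1)).card = m + 1 := by
        rw [hD, hsdcard T _ Subset.rfl (erase_subset _ _), hTm, card_erase_of_mem hb, card_pair hne]; omega
      have hfc := fun T₂ hT₂ h12 => hfar₀ T₂ hT₂ h12 (oflipCM c hc2 s₀ X) (by rw [hD]; exact union_subset_union Subset.rfl (erase_subset _ _))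
      have hbp' : bpot c T₀ (oflipCM c hc2 s₀ X) = m + 1 := by
        rw [← hcard]
        refine bpot_eq_card_dev_of_le_far c hc2 hcen T₀ 𝒯 hbase T₁ hT₁ _ ?_ ?_ ?_
          (fun T₂ hT₂ h12 => ⟨(hfc T₂ hT₂ h12).1.le, (hfc T₂ hT₂ h12).2.le⟩)
        · rw [hn, hcard]; omega
        · rw [hsd, hcard]
        · rw [hn, hsd, hcard]; omega
      have h := hu Q (by rw [hQ, ddist_eq_card_symmDiff c T₀ hc2, hsd, hbp'])
      rw [hQ] at h
      exact hT₀₁ h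
    have hsT : s ∈ T := by
      have hsD : s ∈ T ∪ {a, a'} := hXeq ▸ hs
      rcases mem_union.mp hsD with h | h
      · exact h
      · exact absurd rfl (htie s h s hs hu1)
    have hs'T : s' ∈ T := by
      have hsD : s' ∈ T ∪ {a, a'} := hXeq ▸ hs'
      rcases mem_union.mp hsD with h | h
      · exact h
      · exact absurd rfl (htie s' h s' hs' hu2)
    refine ⟨s, s', hs, hs', hss', hmem, hcornerU s hs hsT, hcornerU s' hs' hs'T, ?_⟩
    have hs'' : s ∈ T₀.1 \ (oflipCM c hc2 s' X).1 := hmem_flip s hs s' hs' hss'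
    obtain ⟨h1, h2⟩ := hcornerU s' hs' hs'T
    rw [dev_oflip c hc2 (mem_sdiff.mp hs'').1 (mem_sdiff.mp hs'').2]
    refine ⟨(erase_subset _ _).trans h1, Or.inr fun h => ?_⟩
    rcases h2 with h2 | h2
    · exact (notMem_erase s _) (h hsT)
    · exact h2 (h.trans (erase_subset _ _))
  · -- below the top: `¬ T ⊆ D`, unique nearest base change `T₀`
    set D := T₀.1 \ X.1 with hDdef
    have hS : D ∩ T ⊆ T := inter_subset_right
    have hB : D ∩ {a, a'} ⊆ ({a, a'} : Finset G) := inter_subset_right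
    have hSlt : (D ∩ T).card < m := by
      rw [← hTm]
      refine card_lt_card (lt_of_le_of_ne inter_subset_right fun h => hnT ?_)
      rw [← h]; exact inter_subset_left
    obtain ⟨hbp, hun⟩ := huniq X (D ∩ T) (D ∩ {a, a'}) hS hB hSlt (hdecomp D hXsub)
    obtain ⟨s, s', hs, hs', hss', hmem⟩ := face_toward_T₀ c hc2 T₀ L hcover X (by rw [hbp]; exact h2) hun
    refine ⟨s, s', hs, hs', hss', hmem, hcornerU' s hs hnT, hcornerU' s' hs' hnT, ?_⟩
    have hs'' : s ∈ T₀.1 \ (oflipCM c hc2 s' X).1 := hmem_flip s hs s' hs' hss'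
    rw [dev_oflip c hc2 (mem_sdiff.mp hs'').1 (mem_sdiff.mp hs'').2,
      dev_oflip c hc2 (mem_sdiff.mp hs').1 (mem_sdiff.mp hs').2]
    exact ⟨((erase_subset _ _).trans (erase_subset _ _)).trans hXsub,
      Or.inr fun h => hnT (h.trans ((erase_subset _ _).trans (erase_subset _ _)))⟩

end Frame

end

end Summit.HodgeConjecture.CorCM.Census.CentralSquares
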